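import Mathlib
import HarnessLib
import Summits.ValiantsHypothesis.ValiantsHypothesis.Theses.MonotoneRestoration
import Literature.Computability.AlgebraicComplexity.ArithCircuit
import Literature.Computability.AlgebraicComplexity.ArithCircuitProofs
import Literature.Computability.AlgebraicComplexity.MonotoneStructure
import Literature.Computability.AlgebraicComplexity.PermanentIrreducible
import Literature.ModelTheory.FiniteModelTheory.CkEquiv
import Summits.ValiantsHypothesis.ValiantsHypothesis.Theorems.MonotoneRestorationMonotoneRestorationQPCosetCount
import Summits.ValiantsHypothesis.ValiantsHypothesis.Theorems.MonotoneRestorationMonotoneRestorationQPSymmetricLB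
import Summits.ValiantsHypothesis.ValiantsHypothesis.Theorems.MonotoneRestorationMonotoneRestorationQPSupportSymmetrisation
import Summits.ValiantsHypothesis.ValiantsHypothesis.Theorems.MonotoneRestorationMonotoneRestorationQPSparseRegime
import Summits.ValiantsHypothesis.ValiantsHypothesis.Theorems.MonotoneRestorationMonotoneRestorationQPBeta
import Literature.Computability.AlgebraicComplexity.SymmetricArithCircuit
import Literature.Computability.AlgebraicComplexity.DawarWilsenach2025Proofs
import Literature.GroupTheory.PermutationGroups.SmallIndexSubgroups
import Summits.ValiantsHypothesis.ValiantsHypothesis.Theorems.MonotoneRestorationQP.Negative.LoadBearing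
import Summits.ValiantsHypothesis.ValiantsHypothesis.Theorems.MonotoneRestorationMonotoneRestorationQPPermSupportCount

/-! TTRL-lite variant V22001 of stmt-ValiantsHypothesis-15886 -/

set_option linter.dupNamespace false

namespace Summit.ValiantsHypothesis.ValiantsHypothesis.Theorems

open Summit.ValiantsHypothesis.ValiantsHypothesis.Theses.MonotoneRestoration
open Literature.Computability.AlgebraicComplexity

/-- TTRL-lite variant V22001 of `stmt-ValiantsHypothesis-15886` (polynomial comparison
have-step of the `gammaArithmetic` stub): for `c ≥ 1`, `t ≥ 1` and `x = t + c` one has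
`2 · (x^c + 2)² ≤ 2^(c+3) · x^(2c)`. Proof: `x ≥ 2` so `x^c ≥ 2`, hence `x^c + 2 ≤ 2·x^c`
and `2 (x^c+2)² ≤ 8 x^(2c) ≤ 2^(c+3) x^(2c)`. The hypothesis `1 ≤ t` is needed
(`(c,t) = (1,0)` gives `18 ≤ 16`). -/
theorem stub_gammaArithmetic_var22001 :
    ∀ (c t : ℕ), 1 ≤ c → 1 ≤ t → 2 * ((t + c) ^ c + 2) ^ 2 ≤ 2 ^ (c + 3) * (t + c) ^ (2 * c) := by
  intro c t hc ht
  -- `y = (t+c)^c ≥ 2`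
  have hx : 2 ≤ t + c := by omega
  have hy : 2 ≤ (t + c) ^ c := by
    calc 2 = 2 ^ 1 := by norm_num
      _ ≤ (t + c) ^ 1 := Nat.pow_le_pow_left hx 1
      _ ≤ (t + c) ^ c := Nat.pow_le_pow_right (by omega) hc
  -- `8 ≤ 2^(c+3)`
  have h8 : 8 ≤ 2 ^ (c + 3) := by
    calc 8 = 2 ^ 3 := by norm_num
      _ ≤ 2 ^ (c + 3) := Nat.pow_le_pow_right (by norm_num) (by omega)
  -- rewrite `(t+c)^(2c) = ((t+c)^c)^2`
  have hpow : (t + c) ^ (2 * c) = ((t + c) ^ c) ^ 2 := by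
    rw [mul_comm, pow_mul]
  rw [hpow]
  set y := (t + c) ^ c with hy_def
  -- `2 (y+2)^2 ≤ 8 y^2 ≤ 2^(c+3) y^2`
  have h1 : 2 * (y + 2) ^ 2 ≤ 8 * y ^ 2 := by nlinarith [hy]
  calc 2 * (y + 2) ^ 2 ≤ 8 * y ^ 2 := h1
    _ ≤ 2 ^ (c + 3) * y ^ 2 := Nat.mul_le_mul_right _ h8

end Summit.ValiantsHypothesis.ValiantsHypothesis.Theorems
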